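import Mathlib
import HarnessLib
import Summits.NavierStokesRegularity.NavierStokesRegularity.Theorems.PoloidalWindowDoorPoloidalWindowRigidityZShockHodographOnto

/-!
# Crux K2 `PoloidalWindowRigidity` (stmt-NavierStokesRegularity-19708), line `z_shock` — NEGATIVE KERNEL BRICK 6b for the class-free
# slice Liouville `hGN`: ★ SURJECTIVITY of the hump two-wave map onto `ℝ²`

`--supports stmt-NavierStokesRegularity-19708 --as helper` (leafhand-ns-poloidalwindowdoor-3 g34, cell decomp-ns, 2026-09-01).
Class-free, def-free; Mathlib + `…HodographOnto` (brick 6a) and bricks 1–5.  **No stub and no summit is closed by this file; Navier–Stokes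
regularity is NOT proved here (rung 0).**  Evidence memo `HGN-COUNTEREXAMPLE-leafhand3-g34.md` §3 (surjectivity, step 2).

* `slice_s_hasDerivAt` — `s`-slices: `∂_s τ = Z_s < 0`, `∂_s ξ = ψ²Z_s`;  `tau_continuousAt` — joint continuity of `τ` on the square;
* `level_continuous` — the level function `s ↦ R(s)` (`ξ(R(s), s) = ξ₀`, brick 6a) is continuous (strict monotonicity in `r` + continuity
  in `s` of the two slices `ξ(R(s₀) ± ε, ·)`);
* `hump_surjective` — ★ for every `(τ₀, ξ₀) ∈ ℝ²` there is `(r, s)` in the open square with `(τ, ξ)(r, s) = (τ₀, ξ₀)`: along the level line of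
  `ξ`, `τ(R(s), s)` is continuous and tends to `∓∞` as `s → ±m` (quantitatively: anchors `s = ±m tanh K`), IVT.
With `…HodographInverse.hump_injective` (p842299) and `…HodographJacobian` (local diffeomorphism): the hump Darboux–hodograph map is a
BIJECTIVE local diffeomorphism of the square onto `ℝ²`, i.e. the eternal bounded two-wave solution of the hump p-system (via
`…HodographSegment.hodograph_duality`) EXISTS GLOBALLY — the kernel content of the refutation of `hGN` in the hodograph plane. [folklore]
-/

noncomputable section

namespace Summit.NavierStokesRegularity.NavierStokesRegularity.Theorems.PoloidalWindowDoorPoloidalWindowRigidityZShockHodographSurjective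

-- the problem directory repeats the summit name (`NavierStokesRegularity/NavierStokesRegularity`)
set_option linter.dupNamespace false

open Real Set
open Summit.NavierStokesRegularity.NavierStokesRegularity.Theorems.PoloidalWindowDoorPoloidalWindowRigidityZShockHodographDarboux
open Summit.NavierStokesRegularity.NavierStokesRegularity.Theorems.PoloidalWindowDoorPoloidalWindowRigidityZShockHodographHump
open Summit.NavierStokesRegularity.NavierStokesRegularity.Theorems.PoloidalWindowDoorPoloidalWindowRigidityZShockHodographSegment
open Summit.NavierStokesRegularity.NavierStokesRegularity.Theorems.PoloidalWindowDoorPoloidalWindowRigidityZShockHodographOnto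

/-- **Slice derivatives in `s`** (fixed `r`): `∂_s τ = Z_s < 0`, `∂_s ξ = ψ²Z_s` (from `segment_point` with `Δr = 0`, `Δs = 1`). [folklore] -/
theorem slice_s_hasDerivAt (m : ℝ) (hm : 0 < m) (hm' : m ≤ 1 / 2) (𝔽 : ℝ → ℝ)
    (h𝔽 : ∀ t, |t| < m → HasDerivAt 𝔽
      (m / 2 * ((1 + t / m) * Real.log (1 + t / m) + (1 - t / m) * Real.log (1 - t / m))) t)
    (r s : ℝ) (hr : |r| < m) (hs : |s| < m) :
    ∃ Zs ψv : ℝ, Zs < 0 ∧ 0 < ψv ∧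
      HasDerivAt (fun s' => ((Real.artanh ((r) / m) - Real.artanh ((s') / m) - Real.tanh (((r) - (s')) / 2) * ((m / 2 * ((1 + (r) / m) * Real.log (1 + (r) / m) + (1 - (r) / m) * Real.log (1 - (r) / m))) + (m / 2 * ((1 + (s') / m) * Real.log (1 + (s') / m) + (1 - (s') / m) * Real.log (1 - (s') / m))))) / (1 - ((r) - (s')) / 2 * Real.tanh (((r) - (s')) / 2)))) Zs s ∧
      HasDerivAt (fun s' => (-(1 - ((r) - (s')) / 2 * Real.tanh (((r) - (s')) / 2)) * (Real.artanh ((r) / m) + Real.artanh ((s') / m)) - ((r) - (s')) / 2 * ((m / 2 * ((1 + (r) / m) * Real.log (1 + (r) / m) + (1 - (r) / m) * Real.log (1 - (r) / m))) - (m / 2 * ((1 + (s') / m) * Real.log (1 + (s') / m) + (1 - (s') / m) * Real.log (1 - (s') / m)))) + (𝔽 (r) + 𝔽 (s')))) (ψv ^ 2 * Zs) s := by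
  have hr' : |r + s * 0| < m := by simpa using hr
  have hs' : |0 + s * 1| < m := by simpa using hs
  obtain ⟨Zr, Zs, ψv, hZr, hZs, hψv, hτ, hξ⟩ := segment_point m hm hm' 𝔽 h𝔽 r 0 0 1 s hr' hs'
  refine ⟨Zs, ψv, hZs, hψv, ?_, ?_⟩
  · have e : (fun t' : ℝ => ((Real.artanh ((r + t' * 0) / m) - Real.artanh ((0 + t' * 1) / m) - Real.tanh (((r + t' * 0) - (0 + t' * 1)) / 2) * ((m / 2 * ((1 + (r + t' * 0) / m) * Real.log (1 + (r + t' * 0) / m) + (1 - (r + t' * 0) / m) * Real.log (1 - (r + t' * 0) / m))) + (m / 2 * ((1 + (0 + t' * 1) / m) * Real.log (1 + (0 + t' * 1) / m) + (1 - (0 + t' * 1) / m) * Real.log (1 - (0 + t' * 1) / m))))) / (1 - ((r + t' * 0) - (0 + t' * 1)) / 2 * Real.tanh (((r + t' * 0) - (0 + t' * 1)) / 2)))) = (fun s' => ((Real.artanh ((r) / m) - Real.artanh ((s') / m) - Real.tanh (((r) - (s')) / 2) * ((m / 2 * ((1 + (r) / m) * Real.log (1 + (r) / m) + (1 - (r)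 / m) * Real.log (1 - (r) / m))) + (m / 2 * ((1 + (s') / m) * Real.log (1 + (s') / m) + (1 - (s') / m) * Real.log (1 - (s') / m))))) / (1 - ((r) - (s')) / 2 * Real.tanh (((r) - (s')) / 2)))) := by
      funext t'; simp only [zero_add, mul_one, mul_zero, add_zero]
    rw [e] at hτ; simpa using hτ
  · have e : (fun t' : ℝ => (-(1 - ((r + t' * 0) - (0 + t' * 1)) / 2 * Real.tanh (((r + t' * 0) - (0 + t' * 1)) / 2)) * (Real.artanh ((r + t' * 0) / m) + Real.artanh ((0 + t' * 1) / m)) - ((r + t' * 0) - (0 + t' * 1)) / 2 * ((m / 2 * ((1 + (r + t' * 0) / m) * Real.log (1 + (r + t' * 0) / m) + (1 - (r + t' * 0) / m) * Real.log (1 - (r + t' * 0) / m))) - (m / 2 * ((1 + (0 + t' * 1) / m) * Real.log (1 + (0 + t' * 1) / m) + (1 - (0 + t' * 1) / m) * Real.log (1 - (0 + t' * 1) / m)))) + (𝔽 (r + t' * 0) + 𝔽 (0 + t' * 1)))) = (fun s' => (-(1 - ((r) - (s')) / 2 * Real.tanh (((r) - (s')) / 2)) * (Real.artanh ((r) / m)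 + Real.artanh ((s') / m)) - ((r) - (s')) / 2 * ((m / 2 * ((1 + (r) / m) * Real.log (1 + (r) / m) + (1 - (r) / m) * Real.log (1 - (r) / m))) - (m / 2 * ((1 + (s') / m) * Real.log (1 + (s') / m) + (1 - (s') / m) * Real.log (1 - (s') / m)))) + (𝔽 (r) + 𝔽 (s')))) := by
      funext t'; simp only [zero_add, mul_one, mul_zero, add_zero]
    rw [e] at hξ; simpa using hξ

/-- **Joint continuity of `τ`** at every point of the open square. [folklore] -/
theorem tau_continuousAt (m : ℝ) (hm : 0 < m) (hm' : m ≤ 1 / 2) (r s : ℝ) (hr : |r| < m) (hs : |s| < m) :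
    ContinuousAt (fun p : ℝ × ℝ => ((Real.artanh ((p.1) / m) - Real.artanh ((p.2) / m) - Real.tanh (((p.1) - (p.2)) / 2) * ((m / 2 * ((1 + (p.1) / m) * Real.log (1 + (p.1) / m) + (1 - (p.1) / m) * Real.log (1 - (p.1) / m))) + (m / 2 * ((1 + (p.2) / m) * Real.log (1 + (p.2) / m) + (1 - (p.2) / m) * Real.log (1 - (p.2) / m))))) / (1 - ((p.1) - (p.2)) / 2 * Real.tanh (((p.1) - (p.2)) / 2)))) (r, s) := by
  have hψ := (psi_bounds m r s hm' hr hs).1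
  have hm2 : 0 < 1 - m ^ 2 := by nlinarith
  have hA : ContinuousAt (fun p : ℝ × ℝ => Real.artanh (p.1 / m)) (r, s) :=
    ContinuousAt.comp (g := fun x : ℝ => Real.artanh (x / m)) (f := fun p : ℝ × ℝ => p.1)
      (hasDerivAt_artanh_div m r hm hr).continuousAt continuousAt_fst
  have hB : ContinuousAt (fun p : ℝ × ℝ => Real.artanh (p.2 / m)) (r, s) :=
    ContinuousAt.comp (g := fun x : ℝ => Real.artanh (x / m)) (f := fun p : ℝ × ℝ => p.2)
      (hasDerivAt_artanh_div m s hm hs).continuousAt continuousAt_snd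
  have hFr : ContinuousAt (fun p : ℝ × ℝ => (m / 2 * ((1 + p.1 / m) * Real.log (1 + p.1 / m) + (1 - p.1 / m) * Real.log (1 - p.1 / m)))) (r, s) :=
    ContinuousAt.comp (g := fun x : ℝ => (m / 2 * ((1 + x / m) * Real.log (1 + x / m) + (1 - x / m) * Real.log (1 - x / m)))) (f := fun p : ℝ × ℝ => p.1)
      (hasDerivAt_prim m r hm hr).continuousAt continuousAt_fst
  have hFs : ContinuousAt (fun p : ℝ × ℝ => (m / 2 * ((1 + p.2 / m) * Real.log (1 + p.2 / m) + (1 - p.2 / m) * Real.log (1 - p.2 / m)))) (r, s) :=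
    ContinuousAt.comp (g := fun x : ℝ => (m / 2 * ((1 + x / m) * Real.log (1 + x / m) + (1 - x / m) * Real.log (1 - x / m)))) (f := fun p : ℝ × ℝ => p.2)
      (hasDerivAt_prim m s hm hs).continuousAt continuousAt_snd
  have hρ : ContinuousAt (fun p : ℝ × ℝ => (p.1 - p.2) / 2) (r, s) :=
    ((continuous_fst.sub continuous_snd).div_const 2).continuousAt
  have hT : ContinuousAt (fun p : ℝ × ℝ => Real.tanh ((p.1 - p.2) / 2)) (r, s) :=
    ContinuousAt.comp (g := Real.tanh) (f := fun p : ℝ × ℝ => (p.1 - p.2) / 2)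
      (hasDerivAt_tanh_one_sub_sq _).continuousAt hρ
  have hden : ContinuousAt (fun p : ℝ × ℝ => 1 - (p.1 - p.2) / 2 * Real.tanh ((p.1 - p.2) / 2)) (r, s) :=
    continuousAt_const.sub (hρ.mul hT)
  exact ((hA.sub hB).sub (hT.mul (hFr.add hFs))).div hden (by simp only; linarith)

set_option maxHeartbeats 400000 in
/-- **Continuity of the level function.**  If `R : ℝ → ℝ` selects, for every `s ∈ (−m,m)`, the point `R s ∈ (−m, m)` with `ξ(R s, s) = ξ₀`
(brick 6a `exists_unique_level`), then `R` is continuous at every `s₀ ∈ (−m, m)`. [folklore] -/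
theorem level_continuous (m : ℝ) (hm : 0 < m) (hm' : m ≤ 1 / 2) (𝔽 : ℝ → ℝ)
    (h𝔽 : ∀ t, |t| < m → HasDerivAt 𝔽
      (m / 2 * ((1 + t / m) * Real.log (1 + t / m) + (1 - t / m) * Real.log (1 - t / m))) t)
    (ξ₀ : ℝ) (R : ℝ → ℝ)
    (hR : ∀ s, |s| < m → R s ∈ Set.Ioo (-m) m ∧ (-(1 - ((R s) - (s)) / 2 * Real.tanh (((R s) - (s)) / 2)) * (Real.artanh ((R s) / m) + Real.artanh ((s) / m)) - ((R s) - (s)) / 2 * ((m / 2 * ((1 + (R s) / m) * Real.log (1 + (R s) / m) + (1 - (R s) / m) * Real.log (1 - (R s) / m))) - (m / 2 * ((1 + (s) / m) * Real.log (1 + (s) / m) + (1 - (s) / m) * Real.log (1 - (s) / m)))) + (𝔽 (R s) + 𝔽 (s))) = ξ₀)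
    (s₀ : ℝ) (hs₀ : |s₀| < m) : ContinuousAt R s₀ := by
  rw [Metric.continuousAt_iff]
  intro ε hε
  obtain ⟨hR0, hR0v⟩ := hR s₀ hs₀
  -- shrink ε so that `R s₀ ± ε'` stay in the square
  obtain ⟨ε', hε', hε'ε, hlo, hhi⟩ : ∃ ε' : ℝ, 0 < ε' ∧ ε' ≤ ε ∧ -m < R s₀ - ε' ∧ R s₀ + ε' < m := by
    refine ⟨min ε (min ((R s₀ + m) / 2) ((m - R s₀) / 2)), ?_, min_le_left _ _, ?_, ?_⟩
    · apply lt_min hε; apply lt_min <;> linarith [hR0.1, hR0.2]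
    · have := min_le_right ε (min ((R s₀ + m) / 2) ((m - R s₀) / 2))
      have := min_le_left ((R s₀ + m) / 2) ((m - R s₀) / 2)
      linarith [hR0.1]
    · have := min_le_right ε (min ((R s₀ + m) / 2) ((m - R s₀) / 2))
      have := min_le_right ((R s₀ + m) / 2) ((m - R s₀) / 2)
      linarith [hR0.2]
  have hlo' : |R s₀ - ε'| < m := abs_lt.mpr ⟨hlo, by linarith [hR0.2]⟩
  have hhi' : |R s₀ + ε'| < m := abs_lt.mpr ⟨by linarith [hR0.1], hhi⟩
  -- the two `s`-slices through `R s₀ ∓ ε'`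
  set φlo : ℝ → ℝ := fun s' => (-(1 - ((R s₀ - ε') - (s')) / 2 * Real.tanh (((R s₀ - ε') - (s')) / 2)) * (Real.artanh ((R s₀ - ε') / m) + Real.artanh ((s') / m)) - ((R s₀ - ε') - (s')) / 2 * ((m / 2 * ((1 + (R s₀ - ε') / m) * Real.log (1 + (R s₀ - ε') / m) + (1 - (R s₀ - ε') / m) * Real.log (1 - (R s₀ - ε') / m))) - (m / 2 * ((1 + (s') / m) * Real.log (1 + (s') / m) + (1 - (s') / m) * Real.log (1 - (s') / m)))) + (𝔽 (R s₀ - ε') + 𝔽 (s'))) with hφlo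
  set φhi : ℝ → ℝ := fun s' => (-(1 - ((R s₀ + ε') - (s')) / 2 * Real.tanh (((R s₀ + ε') - (s')) / 2)) * (Real.artanh ((R s₀ + ε') / m) + Real.artanh ((s') / m)) - ((R s₀ + ε') - (s')) / 2 * ((m / 2 * ((1 + (R s₀ + ε') / m) * Real.log (1 + (R s₀ + ε') / m) + (1 - (R s₀ + ε') / m) * Real.log (1 - (R s₀ + ε') / m))) - (m / 2 * ((1 + (s') / m) * Real.log (1 + (s') / m) + (1 - (s') / m) * Real.log (1 - (s') / m)))) + (𝔽 (R s₀ + ε') + 𝔽 (s'))) with hφhi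
  set φ0 : ℝ → ℝ := fun r' => (-(1 - ((r') - (s₀)) / 2 * Real.tanh (((r') - (s₀)) / 2)) * (Real.artanh ((r') / m) + Real.artanh ((s₀) / m)) - ((r') - (s₀)) / 2 * ((m / 2 * ((1 + (r') / m) * Real.log (1 + (r') / m) + (1 - (r') / m) * Real.log (1 - (r') / m))) - (m / 2 * ((1 + (s₀) / m) * Real.log (1 + (s₀) / m) + (1 - (s₀) / m) * Real.log (1 - (s₀) / m)))) + (𝔽 (r') + 𝔽 (s₀))) with hφ0
  have hanti : StrictAntiOn φ0 (Set.Ioo (-m) m) := (xi_slice_strictAnti m hm hm' 𝔽 h𝔽 s₀ hs₀).1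
  have e0 : φ0 (R s₀) = ξ₀ := hR0v
  have e1 : φ0 (R s₀ - ε') = φlo s₀ := rfl
  have e2 : φ0 (R s₀ + ε') = φhi s₀ := rfl
  have hup : ξ₀ < φlo s₀ := by
    have h := hanti ⟨hlo, by linarith [hR0.2]⟩ hR0 (by linarith)
    rw [e0, e1] at h; exact h
  have hdown : φhi s₀ < ξ₀ := by
    have h := hanti hR0 ⟨by linarith [hR0.1], hhi⟩ (by linarith)
    rw [e0, e2] at h; exact h
  -- continuity in `s` of the two slices at `s₀`
  obtain ⟨Z1, ψ1, -, -, -, hd1⟩ := slice_s_hasDerivAt m hm hm' 𝔽 h𝔽 (R s₀ - ε') s₀ hlo' hs₀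
  obtain ⟨Z2, ψ2, -, -, -, hd2⟩ := slice_s_hasDerivAt m hm hm' 𝔽 h𝔽 (R s₀ + ε') s₀ hhi' hs₀
  have hc1 : ContinuousAt φlo s₀ := hd1.continuousAt
  have hc2 : ContinuousAt φhi s₀ := hd2.continuousAt
  rw [Metric.continuousAt_iff] at hc1 hc2
  obtain ⟨δ1, hδ1, h1⟩ := hc1 _ (sub_pos.mpr hup)
  obtain ⟨δ2, hδ2, h2⟩ := hc2 _ (sub_pos.mpr hdown)
  have hsabs := abs_lt.mp hs₀
  refine ⟨min (min δ1 δ2) (min (s₀ + m) (m - s₀)), ?_, ?_⟩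
  · apply lt_min (lt_min hδ1 hδ2); apply lt_min <;> linarith
  intro s hs
  have hsd : dist s s₀ < min δ1 δ2 := lt_of_lt_of_le hs (min_le_left _ _)
  have hsm : dist s s₀ < min (s₀ + m) (m - s₀) := lt_of_lt_of_le hs (min_le_right _ _)
  have hs' : |s| < m := by
    rw [Real.dist_eq] at hsm
    have a1 := lt_of_lt_of_le hsm (min_le_left _ _)
    have a2 := lt_of_lt_of_le hsm (min_le_right _ _)
    rw [abs_lt] at a1 a2 ⊢; constructor <;> linarith [a1.1, a1.2, a2.1, a2.2]
  have f1 := h1 (lt_of_lt_of_le hsd (min_le_left _ _))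
  have f2 := h2 (lt_of_lt_of_le hsd (min_le_right _ _))
  rw [Real.dist_eq] at f1 f2
  have hup' : ξ₀ < φlo s := by have := (abs_lt.mp f1).1; linarith
  have hdown' : φhi s < ξ₀ := by have := (abs_lt.mp f2).2; linarith
  obtain ⟨hRs, hRsv⟩ := hR s hs'
  set φs : ℝ → ℝ := fun r' => (-(1 - ((r') - (s)) / 2 * Real.tanh (((r') - (s)) / 2)) * (Real.artanh ((r') / m) + Real.artanh ((s) / m)) - ((r') - (s)) / 2 * ((m / 2 * ((1 + (r') / m) * Real.log (1 + (r') / m) + (1 - (r') / m) * Real.log (1 - (r') / m))) - (m / 2 * ((1 + (s) / m) * Real.log (1 + (s) / m) + (1 - (s) / m) * Real.log (1 - (s) / m)))) + (𝔽 (r') + 𝔽 (s))) with hφs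
  have hanti' : StrictAntiOn φs (Set.Ioo (-m) m) := (xi_slice_strictAnti m hm hm' 𝔽 h𝔽 s hs').1
  have g0 : φs (R s) = ξ₀ := hRsv
  have g1 : φs (R s₀ - ε') = φlo s := rfl
  have g2 : φs (R s₀ + ε') = φhi s := rfl
  -- `R s` is squeezed into `(R s₀ − ε', R s₀ + ε')`
  have hlt1 : R s₀ - ε' < R s := by
    by_contra hle
    rw [not_lt] at hle
    have h := hanti'.antitoneOn hRs ⟨hlo, by linarith [hR0.2]⟩ hle
    rw [g0, g1] at h; linarith
  have hlt2 : R s < R s₀ + ε' := by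
    by_contra hle
    rw [not_lt] at hle
    have h := hanti'.antitoneOn ⟨by linarith [hR0.1], hhi⟩ hRs hle
    rw [g0, g2] at h; linarith
  rw [Real.dist_eq, abs_lt]
  constructor <;> linarith

set_option maxHeartbeats 400000 in
/-- ★ **SURJECTIVITY of the hump two-wave map onto `ℝ²`.**  For every `(τ₀, ξ₀)` there is a point of the open square `|r|, |s| < m`
(`0 < m ≤ 1/2`) where the Darboux–hodograph pair takes the value `(τ₀, ξ₀)`. [folklore] -/
theorem hump_surjective (m : ℝ) (hm : 0 < m) (hm' : m ≤ 1 / 2) (𝔽 : ℝ → ℝ)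
    (h𝔽 : ∀ t, |t| < m → HasDerivAt 𝔽
      (m / 2 * ((1 + t / m) * Real.log (1 + t / m) + (1 - t / m) * Real.log (1 - t / m))) t)
    (τ₀ ξ₀ : ℝ) :
    ∃ r s : ℝ, |r| < m ∧ |s| < m ∧ ((Real.artanh ((r) / m) - Real.artanh ((s) / m) - Real.tanh (((r) - (s)) / 2) * ((m / 2 * ((1 + (r) / m) * Real.log (1 + (r) / m) + (1 - (r) / m) * Real.log (1 - (r) / m))) + (m / 2 * ((1 + (s) / m) * Real.log (1 + (s) / m) + (1 - (s) / m) * Real.log (1 - (s) / m))))) / (1 - ((r) - (s)) / 2 * Real.tanh (((r) - (s)) / 2))) = τ₀ ∧ (-(1 - ((r) - (s)) / 2 * Real.tanh (((r) - (s)) / 2)) * (Real.artanh ((r) / m) + Real.artanh ((s) / m)) - ((r) - (s)) / 2 * ((m / 2 * ((1 + (r) / m) * Real.log (1 + (r) / m) + (1 - (r) / m) * Real.log (1 - (r) / m))) - (m / 2 * ((1 + (s) / m) * Real.log (1 + (s) / m) + (1 - (s) / m) * Real.log (1 - (s) / m)))) + (𝔽 (r) + 𝔽 (s))) = ξ₀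 := by
  have hm2 : 0 < 1 - m ^ 2 := by nlinarith
  -- the level function of `ξ = ξ₀`
  have hex : ∀ s, |s| < m → ∃ r, r ∈ Set.Ioo (-m) m ∧ (-(1 - ((r) - (s)) / 2 * Real.tanh (((r) - (s)) / 2)) * (Real.artanh ((r) / m) + Real.artanh ((s) / m)) - ((r) - (s)) / 2 * ((m / 2 * ((1 + (r) / m) * Real.log (1 + (r) / m) + (1 - (r) / m) * Real.log (1 - (r) / m))) - (m / 2 * ((1 + (s) / m) * Real.log (1 + (s) / m) + (1 - (s) / m) * Real.log (1 - (s) / m)))) + (𝔽 (r) + 𝔽 (s))) = ξ₀ := fun s hs =>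
    (exists_unique_level m hm hm' 𝔽 h𝔽 ξ₀ s hs).exists
  choose! R hR using hex
  -- `g(s) = τ(R s, s)` is continuous on `(−m, m)`
  set g : ℝ → ℝ := (fun p : ℝ × ℝ => ((Real.artanh ((p.1) / m) - Real.artanh ((p.2) / m) - Real.tanh (((p.1) - (p.2)) / 2) * ((m / 2 * ((1 + (p.1) / m) * Real.log (1 + (p.1) / m) + (1 - (p.1) / m) * Real.log (1 - (p.1) / m))) + (m / 2 * ((1 + (p.2) / m) * Real.log (1 + (p.2) / m) + (1 - (p.2) / m) * Real.log (1 - (p.2) / m))))) / (1 - ((p.1) - (p.2)) / 2 * Real.tanh (((p.1) - (p.2)) / 2)))) ∘ (fun s' : ℝ => (R s', s')) with hg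
  have hgc : ∀ s, |s| < m → ContinuousAt g s := by
    intro s hs
    obtain ⟨hRs, -⟩ := hR s hs
    have hRabs : |R s| < m := abs_lt.mpr ⟨hRs.1, hRs.2⟩
    have hτc := tau_continuousAt m hm hm' (R s) s hRabs hs
    have hRc := level_continuous m hm hm' 𝔽 h𝔽 ξ₀ R hR s hs
    have hpair : ContinuousAt (fun s' : ℝ => (R s', s')) s := hRc.prodMk continuousAt_id
    exact ContinuousAt.comp hτc hpair
  -- a priori bound along the level line: |artanh(R s / m) + artanh(s/m)| ≤ C₁
  set C₀ : ℝ := 3 * m ^ 2 + 2 * |𝔽 0| with hC₀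
  set C₁ : ℝ := (C₀ + |ξ₀|) / (1 - m ^ 2) with hC₁
  have hC₁0 : 0 ≤ C₁ := by positivity
  have hsumb : ∀ s, |s| < m → |Real.artanh (R s / m) + Real.artanh (s / m)| ≤ C₁ := by
    intro s hs
    obtain ⟨hRs, hRv⟩ := hR s hs
    have hRabs : |R s| < m := abs_lt.mpr ⟨hRs.1, hRs.2⟩
    have hb := xi_core_bound m hm 𝔽 h𝔽 (R s) s hRabs hs
    rw [hRv] at hb
    obtain ⟨hψ1, hψ2⟩ := psi_bounds m (R s) s hm' hRabs hs
    set ψv := 1 - (R s - s) / 2 * Real.tanh ((R s - s) / 2)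
    set A := Real.artanh (R s / m) + Real.artanh (s / m)
    have h1 : |ψv * A| ≤ C₀ + |ξ₀| := by
      have := abs_add_le (ξ₀ + ψv * A) (-ξ₀)
      have e : ξ₀ + ψv * A + -ξ₀ = ψv * A := by ring
      rw [e, abs_neg] at this; linarith
    rw [abs_mul, abs_of_pos (by linarith)] at h1
    rw [hC₁, le_div_iff₀ hm2]
    calc |A| * (1 - m ^ 2) ≤ |A| * ψv := mul_le_mul_of_nonneg_left hψ1 (abs_nonneg _)
      _ = ψv * |A| := mul_comm _ _
      _ ≤ C₀ + |ξ₀| := h1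
  -- bounds for `g`
  have hgb : ∀ s, |s| < m →
      (Real.artanh (R s / m) - Real.artanh (s / m) + 2 * m ≤ -1 →
        g s ≤ Real.artanh (R s / m) - Real.artanh (s / m) + 2 * m) ∧
      (1 ≤ Real.artanh (R s / m) - Real.artanh (s / m) - 2 * m →
        Real.artanh (R s / m) - Real.artanh (s / m) - 2 * m ≤ g s) := by
    intro s hs
    obtain ⟨hRs, hRv⟩ := hR s hs
    have hRabs : |R s| < m := abs_lt.mpr ⟨hRs.1, hRs.2⟩
    obtain ⟨hψ1, hψ2⟩ := psi_bounds m (R s) s hm' hRabs hs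
    have hψ0 : 0 < 1 - (R s - s) / 2 * Real.tanh ((R s - s) / 2) := by linarith
    have hFr0 := prim_nonneg m (R s) hm hRabs; have hFr1 := prim_le m (R s) hm hRabs
    have hFs0 := prim_nonneg m s hm hs; have hFs1 := prim_le m s hm hs
    have hT : |Real.tanh ((R s - s) / 2)| ≤ 1 := (Real.abs_tanh_lt_one _).le
    have hTF : |Real.tanh ((R s - s) / 2) * ((m / 2 * ((1 + (R s) / m) * Real.log (1 + (R s) / m) + (1 - (R s) / m) * Real.log (1 - (R s) / m))) + (m / 2 * ((1 + (s) / m) * Real.log (1 + (s) / m) + (1 - (s) / m) * Real.log (1 - (s) / m))))| ≤ 2 * m := by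
      rw [abs_mul]
      calc _ ≤ 1 * (2 * m) := by
            apply mul_le_mul hT _ (abs_nonneg _) zero_le_one
            rw [abs_le]; constructor <;> linarith
        _ = 2 * m := one_mul _
    obtain ⟨hTF1, hTF2⟩ := abs_le.mp hTF
    set N := Real.artanh (R s / m) - Real.artanh (s / m) -
      Real.tanh ((R s - s) / 2) * ((m / 2 * ((1 + (R s) / m) * Real.log (1 + (R s) / m) + (1 - (R s) / m) * Real.log (1 - (R s) / m))) + (m / 2 * ((1 + (s) / m) * Real.log (1 + (s) / m) + (1 - (s) / m) * Real.log (1 - (s) / m)))) with hN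
    set ψv := 1 - (R s - s) / 2 * Real.tanh ((R s - s) / 2) with hψv
    have hgs : g s = N / ψv := by simp only [hg, hN, hψv, Function.comp]
    constructor
    · intro hneg
      have hN0 : N ≤ 0 := by rw [hN]; linarith
      rw [hgs]
      have : N / ψv ≤ N := by
        rw [div_le_iff₀ hψ0]; nlinarith
      linarith
    · intro hpos
      have hN0 : 0 ≤ N := by rw [hN]; linarith
      rw [hgs]
      have : N ≤ N / ψv := by
        rw [le_div_iff₀ hψ0]; nlinarith
      linarith
  -- anchors `s± = ± m tanh K`
  set K : ℝ := C₁ + 2 * m + |τ₀| + 1 with hK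
  have hKpos : 0 < K := by positivity
  have hanc : ∀ σ : ℝ, (σ = 1 ∨ σ = -1) → |m * Real.tanh (σ * K)| < m ∧
      Real.artanh (m * Real.tanh (σ * K) / m) = σ * K := by
    intro σ hσ
    constructor
    · rw [abs_mul, abs_of_pos hm]
      have := Real.abs_tanh_lt_one (σ * K)
      nlinarith
    · rw [mul_div_cancel_left₀ _ hm.ne', Real.artanh_tanh]
  obtain ⟨hhi, ahi⟩ := hanc 1 (Or.inl rfl)
  obtain ⟨hlo, alo⟩ := hanc (-1) (Or.inr rfl)
  rw [one_mul] at hhi ahi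
  have vhi : g (m * Real.tanh K) < τ₀ := by
    have hb := abs_le.mp (hsumb _ hhi)
    rw [ahi] at hb
    have h := (hgb _ hhi).1
    rw [ahi] at h
    have hτ := neg_abs_le τ₀
    have hτ' := abs_nonneg τ₀
    have : Real.artanh (R (m * Real.tanh K) / m) - K + 2 * m ≤ -1 := by linarith [hb.2]
    have := h this
    linarith [hb.2]
  have vlo : τ₀ < g (m * Real.tanh (-1 * K)) := by
    have hb := abs_le.mp (hsumb _ hlo)
    rw [alo] at hb
    have h := (hgb _ hlo).2
    rw [alo] at h
    have hτ := le_abs_self τ₀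
    have hτ' := abs_nonneg τ₀
    have : 1 ≤ Real.artanh (R (m * Real.tanh (-1 * K)) / m) - -1 * K - 2 * m := by linarith [hb.1]
    have := h this
    linarith [hb.1]
  -- IVT for `g` on the segment between the anchors
  have hlo' := abs_lt.mp hlo; have hhi' := abs_lt.mp hhi
  have hsub : Set.uIcc (m * Real.tanh (-1 * K)) (m * Real.tanh K) ⊆ Set.Ioo (-m) m := by
    intro x hx
    rw [Set.mem_uIcc] at hx
    constructor <;> rcases hx with ⟨h1, h2⟩ | ⟨h1, h2⟩ <;> linarith
  have hgcont : ContinuousOn g (Set.uIcc (m * Real.tanh (-1 * K)) (m * Real.tanh K)) := fun x hx =>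
    (hgc x (abs_lt.mpr ⟨(hsub hx).1, (hsub hx).2⟩)).continuousWithinAt
  have hmem : τ₀ ∈ Set.uIcc (g (m * Real.tanh (-1 * K))) (g (m * Real.tanh K)) := by
    rw [Set.mem_uIcc]; right; exact ⟨vhi.le, vlo.le⟩
  obtain ⟨s, hsI, hsv⟩ := intermediate_value_uIcc hgcont hmem
  have hs : |s| < m := abs_lt.mpr ⟨(hsub hsI).1, (hsub hsI).2⟩
  obtain ⟨hRs, hRv⟩ := hR s hs
  simp only [hg, Function.comp] at hsv
  exact ⟨R s, s, abs_lt.mpr ⟨hRs.1, hRs.2⟩, hs, hsv, hRv⟩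

end Summit.NavierStokesRegularity.NavierStokesRegularity.Theorems.PoloidalWindowDoorPoloidalWindowRigidityZShockHodographSurjective
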